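import Summits.SmoothPoincare4.SmoothPoincare4.Theses.SchoenfliesSplit

/-!
# `SchsplitCerf` without the gluing predicate is false (negative lemma, crux stmt-SmoothPoincare4-8758)

`SchoenfliesSplit.SchsplitCerf` concludes `T.carrier ≅ S⁴` for `T : TwistedSphere 3 φ`.  Deleting the
field `isTwistedSphere` (keeping every other field of the bundle: compact, Hausdorff,
second-countable, smooth 4-manifold) leaves "every compact smooth 4-manifold is `S⁴`", refuted by the
minimal junk inhabitant of those binders, the EMPTY manifold (Mathlib `ChartedSpace.empty`,
`IsManifold.empty`).  So the gluing predicate carries the entire content; cdisprove seat.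
-/

noncomputable section

-- the prescribed namespace `Summit.<P>.<Sub>.…` duplicates `SmoothPoincare4` (P = Sub)
set_option linter.dupNamespace false

open scoped Manifold ContDiff Topology

namespace Summit.SmoothPoincare4.SmoothPoincare4.Theorems.SchsplitCerf.Negative

/-- **`SchsplitCerf` minus the gluing predicate is false**: not every compact Hausdorff
second-countable smooth 4-manifold is diffeomorphic to `S⁴` — the empty one is not. [folklore] -/
theorem schsplitCerf_false_without_gluing :
    ¬ ∀ (M : Type) [TopologicalSpace M] [T2Space M] [SecondCountableTopology M] [CompactSpace M]
        [ChartedSpace (EuclideanSpace ℝ (Fin 4)) M] [IsManifold (𝓡 4) ∞ M],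
        Nonempty (M ≃ₘ⟮𝓡 4, 𝓡 4⟯ (Metric.sphere (0 : EuclideanSpace ℝ (Fin 5)) 1)) := by
  intro h
  letI : ChartedSpace (EuclideanSpace ℝ (Fin 4)) Empty := ChartedSpace.empty _ _
  obtain ⟨e⟩ := h Empty
  have p : Metric.sphere (0 : EuclideanSpace ℝ (Fin 5)) 1 := ⟨EuclideanSpace.single 0 1, by simp⟩
  exact (e.symm p).elim

end Summit.SmoothPoincare4.SmoothPoincare4.Theorems.SchsplitCerf.Negative

end
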